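import Literature.NumberTheory.ComplexMultiplication.CMOrderGeneratorsOverordersType
import Mathlib.RingTheory.DedekindDomain.Factorization
import HarnessLib

/-!
# Superficial elements when few primes lie over `𝔭`, and LEMMA 4.3 / COROLLARY 4.4 / THEOREM 4.7 beyond binary branching

[cite: Greither1982TwoGenerator, §2 Thm. 2.1 (proof: «`mS = ∏ nᵢ^{eᵢ}` … applying [ZS, VIII Thm. 24]», the
superficial element `x` with `xS_m = mS_m`), p. 267; Cor. 2.2 and Thm. 2.3, p. 268]
[cite: Marseglia2024CMType, §4 Lemma 4.3, Cor. 4.4, Prop. 4.5 and Thm. 4.7, pp. 10–11]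

GREITHER's proof of THEOREM 2.1 «`v(R) = e(R) = [S/mS : R/m]`» needs, at a maximal ideal `m` of the
one-dimensional ring `R` with normalisation `S`, an element `x ∈ m` generating `mS` locally at every maximal ideal
of `S` above `m` (a superficial element: `mS ⊆ xS + (mS)²`); over a finite residue field such an element need not
exist, and the printed proof passes to an extension of the residue field (multiplicity theory).  The file
`CMOrderIdealGeneratorsMaximalOrderBound` (g29-#1) produced `x` when at most TWO primes of `S` lie over `m`.  This
file proves the sharp elementary criterion: **a superficial element exists in `m` as soon as the number of primes
of `S` above `m` is at most `#(R/m)`** (§§1–2: an ideal `𝔭` with finite residue field is not the union of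
`r ≤ #(R/𝔭)` ideals `B` with `𝔭² ⊆ B ⊊ 𝔭`-relative, by the `y + tx` pigeonhole), and re-derives the consequences
of g29-#1 and of `CMOrderGeneratorsOverordersType` (g29-#5) under this weaker hypothesis for the orders
`S = endOrder (M_μ)`: GREITHER THM. 2.1's inequality `dim I/𝔭I ≤ dim 𝒪_K/𝔭𝒪_K`, MARSEGLIA LEMMA 4.3
`gens_S(I) ≤ max{2, gens_S(𝒪_K)}`, COROLLARY 4.4 `gens(S) = gens_S(𝒪_K) = max_𝔭 dim 𝒪_K/𝔭𝒪_K`, and THEOREM 4.7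
(i) ⟺ (iii) ⟺ (vi).  Since `#(S/𝔭) ≥ 2`, binary branching is the special case `r ≤ 2` (§3
`card_le_natCard_quotient_of_binaryBranching`).

## What is formalised

* §1 `NumberRing.exists_mem_forall_not_mem_of_card_le`: for a maximal ideal `𝔭` with finite residue ring and
  `r ≤ #(R/𝔭)` ideals `B₁, …, B_r` with `𝔭² ⊆ Bᵢ`, `𝔭 ⊄ Bᵢ`, some `x ∈ 𝔭` avoids all `Bᵢ`.
* §2 `NumberRing.exists_mem_map_le_span_singleton_sup_sq_of_card_le`: for `f : R → D` into a Dedekind domain,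
  `J = 𝔭D ≠ 0` with at most `#(R/𝔭)` maximal ideals above it, some `x ∈ 𝔭` has `J ⊆ f(x)D + J²`.
* §3 (`𝔯 = endOrder ρ`): `EndOrder.exists_mem_coeIdeal_mul_le_of_card_le` (transport to `𝔭M ⊆ xM + 𝔭²M`),
  `EndOrder.card_le_natCard_quotient_of_binaryBranching`.
* §4 (`S = endOrder (M_μ)`): `finrank_quotient_smul_top_le_of_card_le` (THM. 2.1's inequality),
  **`spanFinrank_coe_le_max_of_card_le`** (LEMMA 4.3), **`iSup_spanFinrank_coe_eq_spanFinrank_coe_of_card_le`**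
  (COR. 4.4), `iSup_spanFinrank_coe_eq_iSup_finrank_quotient_smul_top_of_card_le`,
  `exists_not_isUnit_forall_iSup_add_one_eq_iSup_spanFinrank_of_card_le` (PROP. 4.5 «in particular»),
  `iSup_spanFinrank_coe_eq_spanFinrank_top_quotient_add_one_of_card_le` (THM. 4.7 (iii) ⟺ (vi)) and
  **`forall_le_and_exists_eq_iSup_spanFinrank_of_card_le`** (THM. 4.7 (i) ⟺ (vi)).
-/

noncomputable section

open scoped nonZeroDivisors NumberField
open NumberField Module FractionalIdeal IsDedekindDomain
open Submodule (traceDual)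

namespace Literature.NumberTheory.ComplexMultiplication

namespace NumberRing

/-! ## §1 An ideal with finite residue field is not the union of few intermediate ideals -/

section Avoid

variable {R : Type*} [CommRing R]

/-- **Avoidance with a finite residue field: if `𝔭` is maximal with `#(R/𝔭) = q` and `B₁, …, B_r` (`r ≤ q`) are ideals
with `𝔭² ⊆ Bᵢ` and `𝔭 ⊄ Bᵢ`, then some `x ∈ 𝔭` lies in no `Bᵢ`** (induction on `r`: either some `Bᵢ ∩ 𝔭` is covered
by the others, or pick `x ∈ 𝔭 ∩ B₁` outside the others and `y ∈ 𝔭 ∖ B₁`; the `q` elements `y + tx`, `t` running over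
representatives of `R/𝔭`, avoid `B₁`, and two of them in one `Bᵢ` would put `(t − t′)x`, hence `x`, in `Bᵢ`).  This
replaces the residue-field extension of the printed multiplicity argument when `r ≤ q`.
[cite: Greither1982TwoGenerator, §2 Thm. 2.1 (proof), p. 267] -/
theorem exists_mem_forall_not_mem_of_card_le {𝔭 : Ideal R} [h𝔭 : 𝔭.IsMaximal] [Finite (R ⧸ 𝔭)]
    (𝒮 : Finset (Ideal R)) (h𝒮 : 𝒮.card ≤ Nat.card (R ⧸ 𝔭))
    (hsq : ∀ B ∈ 𝒮, 𝔭 * 𝔭 ≤ B) (hne : ∀ B ∈ 𝒮, ¬ 𝔭 ≤ B) :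
    ∃ x ∈ 𝔭, ∀ B ∈ 𝒮, x ∉ B := by
  classical
  suffices H : ∀ n (𝒮 : Finset (Ideal R)), 𝒮.card = n → 𝒮.card ≤ Nat.card (R ⧸ 𝔭) →
      (∀ B ∈ 𝒮, 𝔭 * 𝔭 ≤ B) → (∀ B ∈ 𝒮, ¬ 𝔭 ≤ B) → ∃ x ∈ 𝔭, ∀ B ∈ 𝒮, x ∉ B from
    H _ 𝒮 rfl h𝒮 hsq hne
  intro n
  refine Nat.strong_induction_on n fun n ih ↦ ?_
  intro 𝒮 hcard hle hsq hne
  by_cases hred : ∃ B₀ ∈ 𝒮, ∀ x ∈ 𝔭, x ∈ B₀ → ∃ B ∈ 𝒮.erase B₀, x ∈ B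
  · -- a redundant member: induct
    obtain ⟨B₀, hB₀, hB₀red⟩ := hred
    have hpos : 0 < 𝒮.card := Finset.card_pos.2 ⟨B₀, hB₀⟩
    have hlt : (𝒮.erase B₀).card < n := by rw [Finset.card_erase_of_mem hB₀]; omega
    obtain ⟨x, hx, hxB⟩ := ih _ hlt (𝒮.erase B₀) rfl (Finset.card_erase_le.trans hle)
      (fun B hB ↦ hsq B (Finset.mem_of_mem_erase hB)) (fun B hB ↦ hne B (Finset.mem_of_mem_erase hB))
    refine ⟨x, hx, fun B hB hxB' ↦ ?_⟩
    by_cases hBB₀ : B = B₀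
    · subst hBB₀
      obtain ⟨B', hB', hxB''⟩ := hB₀red x hx hxB'
      exact hxB B' hB' hxB''
    · exact hxB B (Finset.mem_erase.2 ⟨hBB₀, hB⟩) hxB'
  · push Not at hred
    rcases 𝒮.eq_empty_or_nonempty with hempty | ⟨B₁, hB₁⟩
    · exact ⟨0, 𝔭.zero_mem, by simp [hempty]⟩
    obtain ⟨x, hx𝔭, hxB₁, hxB⟩ := hred B₁ hB₁
    obtain ⟨y, hy𝔭, hyB₁⟩ : ∃ y ∈ 𝔭, y ∉ B₁ := SetLike.not_le_iff_exists.1 (hne B₁ hB₁)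
    haveI := Fintype.ofFinite (R ⧸ 𝔭)
    choose t ht using fun c : R ⧸ 𝔭 ↦ Ideal.Quotient.mk_surjective c
    by_contra hcon
    push Not at hcon
    -- each `y + t_c x` lies in a member other than `B₁`
    have hz : ∀ c : R ⧸ 𝔭, ∃ B ∈ 𝒮.erase B₁, y + t c * x ∈ B := fun c ↦ by
      obtain ⟨B, hB, hzB⟩ := hcon (y + t c * x) (𝔭.add_mem hy𝔭 (𝔭.mul_mem_left _ hx𝔭))
      refine ⟨B, Finset.mem_erase.2 ⟨?_, hB⟩, hzB⟩
      rintro rfl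
      exact hyB₁ ((Submodule.add_mem_iff_left _ (B.mul_mem_left _ hxB₁)).1 hzB)
    choose g hg hzg using hz
    -- pigeonhole: `q` residues, at most `q - 1` members
    have hlt' : (𝒮.erase B₁).card < (Finset.univ : Finset (R ⧸ 𝔭)).card := by
      rw [Finset.card_erase_of_mem hB₁, Finset.card_univ, ← Nat.card_eq_fintype_card]
      have : 0 < 𝒮.card := Finset.card_pos.2 ⟨B₁, hB₁⟩
      omega
    obtain ⟨c₁, -, c₂, -, hne', hgc⟩ :=
      Finset.exists_ne_map_eq_of_card_lt_of_maps_to hlt' (f := g) fun c _ ↦ hg c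
    have hdx : (t c₁ - t c₂) * x ∈ g c₁ := by
      have h := Submodule.sub_mem _ (hzg c₁) (hgc ▸ hzg c₂)
      rwa [show y + t c₁ * x - (y + t c₂ * x) = (t c₁ - t c₂) * x by ring] at h
    have hu : t c₁ - t c₂ ∉ 𝔭 := fun h ↦ hne' (by rw [← ht c₁, ← ht c₂]; exact Ideal.Quotient.eq.2 h)
    obtain ⟨a, p, hp, hap⟩ := h𝔭.exists_inv hu
    have hxg : x ∈ g c₁ := by
      have h1 : x = a * ((t c₁ - t c₂) * x) + p * x := by rw [← mul_assoc, ← add_mul, hap, one_mul]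
      rw [h1]
      exact Ideal.add_mem _ (Ideal.mul_mem_left _ _ hdx)
        (hsq _ (Finset.mem_of_mem_erase (hg c₁)) (Ideal.mul_mem_mul hp hx𝔭))
    exact hxB (g c₁) (hg c₁) hxg

end Avoid

/-! ## §2 Superficial elements exist when at most `#(R/𝔭)` primes lie over `𝔭` (any Dedekind domain) -/

section Dedekind

variable {R D : Type*} [CommRing R] [CommRing D] [IsDedekindDomain D] (f : R →+* D)

/-- **If at most `#(R/𝔭)` maximal ideals of the Dedekind domain `D` contain `J = 𝔭D ≠ 0`, then some `x ∈ 𝔭` has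
`J ⊆ f(x)D + J²`** — `f(x)` generates `J` locally at every prime («`xS_m = mS_m`»).  Proof: the elements of `𝔭`
failing at the maximal `𝔔 ⊇ J` form the ideal `B_𝔔 = 𝔭 ∩ f⁻¹(J𝔔) ⊉ 𝔭`, which contains `𝔭²`; §1 applies to the
`B_𝔔`.  For at most two primes this is g29-#1's `exists_mem_map_le_span_singleton_sup_sq`; in general the bound
`r ≤ #(R/𝔭)` is where the finite residue field stops the printed argument. [cite: Greither1982TwoGenerator, §2
Thm. 2.1 (proof), p. 267] -/
theorem exists_mem_map_le_span_singleton_sup_sq_of_card_le {𝔭 : Ideal R} [h𝔭 : 𝔭.IsMaximal] [Finite (R ⧸ 𝔭)]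
    (hJ0 : 𝔭.map f ≠ ⊥)
    (hq : ∀ 𝒬 : Finset (Ideal D), (∀ Q ∈ 𝒬, Q.IsMaximal ∧ 𝔭.map f ≤ Q) → 𝒬.card ≤ Nat.card (R ⧸ 𝔭)) :
    ∃ x ∈ 𝔭, 𝔭.map f ≤ Ideal.span {f x} ⊔ 𝔭.map f ^ 2 := by
  classical
  -- the finite set of maximal ideals above `J`
  set 𝒬 : Finset (Ideal D) := (Ideal.finite_factors hJ0).toFinset.image
    (fun v : HeightOneSpectrum D ↦ v.asIdeal) with h𝒬
  have hmem : ∀ Q : Ideal D, Q.IsMaximal → 𝔭.map f ≤ Q → Q ∈ 𝒬 := fun Q hQ hJQ ↦ by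
    rw [h𝒬, Finset.mem_image]
    have hQ0 : Q ≠ ⊥ := fun h ↦ hJ0 (le_bot_iff.1 (h ▸ hJQ))
    exact ⟨⟨Q, hQ.isPrime, hQ0⟩, (Set.Finite.mem_toFinset _).2 (Ideal.dvd_iff_le.2 hJQ), rfl⟩
  have h𝒬max : ∀ Q ∈ 𝒬, Q.IsMaximal ∧ 𝔭.map f ≤ Q := fun Q hQ ↦ by
    rw [h𝒬, Finset.mem_image] at hQ
    obtain ⟨v, hv, rfl⟩ := hQ
    rw [Set.Finite.mem_toFinset] at hv
    exact ⟨v.isPrime.isMaximal v.ne_bot, Ideal.le_of_dvd hv⟩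
  set g : Ideal D → Ideal R := fun Q ↦ 𝔭 ⊓ (𝔭.map f * Q).comap f with hg
  have hsq : ∀ B ∈ 𝒬.image g, 𝔭 * 𝔭 ≤ B := fun B hB ↦ by
    obtain ⟨Q, hQ, rfl⟩ := Finset.mem_image.1 hB
    refine le_inf Ideal.mul_le_right ?_
    rw [← Ideal.map_le_iff_le_comap, Ideal.map_mul]
    exact Ideal.mul_mono_right (h𝒬max Q hQ).2
  have hne : ∀ B ∈ 𝒬.image g, ¬ 𝔭 ≤ B := fun B hB hle ↦ by
    obtain ⟨Q, hQ, rfl⟩ := Finset.mem_image.1 hB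
    obtain ⟨t, ht, htQ⟩ := exists_mem_map_not_mem_mul f hJ0 (h𝒬max Q hQ).1
    exact htQ (Ideal.mem_comap.1 (hle ht).2)
  obtain ⟨x, hx, hxB⟩ := exists_mem_forall_not_mem_of_card_le (𝔭 := 𝔭) (𝒬.image g)
    (Finset.card_image_le.trans (hq 𝒬 h𝒬max)) hsq hne
  refine ⟨x, hx, (le_span_singleton_sup_sq_or_exists_mem_mul f hJ0 hx).resolve_right ?_⟩
  rintro ⟨Q, hQ, hJQ, hxQ⟩
  exact hxB (g Q) (Finset.mem_image_of_mem g (hmem Q hQ hJQ)) ⟨hx, Ideal.mem_comap.2 hxQ⟩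

end Dedekind

end NumberRing

/-! ## §3 Transport to the order `𝔯 = endOrder ρ` -/

namespace EndOrder

section Transport

variable {K : Type} [Field K] [NumberField K]
variable {ι : Type} [Fintype ι] [DecidableEq ι] [Nonempty ι] {ρ : K →ₐ[ℚ] Matrix ι ι ℚ}
variable [IsFractionRing (endOrder ρ) K]

/-- **A superficial element of `𝔭` for `𝒪_K` exists when at most `#(𝔯/𝔭)` primes of `𝒪_K` lie over the maximal
ideal `𝔭` of the order `𝔯 = endOrder ρ`: `x ∈ 𝔭` with `𝔭𝒪_K ⊆ x𝒪_K + 𝔭²𝒪_K`** (§2 in `𝓞 K`, transported by g29-#1's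
`coeIdeal_mul_le_of_map_le_span_singleton_sup_sq`). [cite: Greither1982TwoGenerator, §2 Thm. 2.1 (proof), p. 267] -/
theorem exists_mem_coeIdeal_mul_le_of_card_le {M : FractionalIdeal (endOrder ρ)⁰ K}
    (hMO : (M : Set K) = (algebraMap (𝓞 K) K).range) {𝔭 : Ideal (endOrder ρ)} [h𝔭 : 𝔭.IsMaximal]
    (hq : ∀ 𝒬 : Finset (Ideal (𝓞 K)), (∀ Q ∈ 𝒬, Q.IsMaximal ∧ 𝔭.map (toRingOfIntegers ρ) ≤ Q) →
      𝒬.card ≤ Nat.card (endOrder ρ ⧸ 𝔭)) :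
    ∃ x ∈ 𝔭, (𝔭 : FractionalIdeal (endOrder ρ)⁰ K) * M ≤
      ((Ideal.span {x} : Ideal (endOrder ρ)) : FractionalIdeal (endOrder ρ)⁰ K) * M +
        (𝔭 : FractionalIdeal (endOrder ρ)⁰ K) ^ 2 * M := by
  have h0 : 𝔭 ≠ ⊥ := Ring.ne_bot_of_isMaximal_of_not_isField h𝔭 not_isField
  haveI := CMTypeLattice.finite_quotient_endOrder ρ h0
  obtain ⟨x, hx, h⟩ := NumberRing.exists_mem_map_le_span_singleton_sup_sq_of_card_le (toRingOfIntegers ρ)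
    (map_toRingOfIntegers_ne_bot h0) hq
  exact ⟨x, hx, coeIdeal_mul_le_of_map_le_span_singleton_sup_sq hMO h⟩

omit [IsFractionRing (endOrder ρ) K] in
/-- **Binary branching is the case `r ≤ 2 ≤ #(𝔯/𝔭)`**: if among any three maximal ideals of `𝒪_K` above `𝔭` two
coincide, every finite set of such ideals has at most `2 ≤ #(𝔯/𝔭)` elements. [cite: Greither1982TwoGenerator, §2
Thm. 2.3 («binary branching»), p. 268] -/
theorem card_le_natCard_quotient_of_binaryBranching {𝔭 : Ideal (endOrder ρ)} [h𝔭 : 𝔭.IsMaximal]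
    (h3 : ∀ Q₁ Q₂ Q₃ : Ideal (𝓞 K), Q₁.IsMaximal → Q₂.IsMaximal → Q₃.IsMaximal →
      𝔭.map (toRingOfIntegers ρ) ≤ Q₁ → 𝔭.map (toRingOfIntegers ρ) ≤ Q₂ → 𝔭.map (toRingOfIntegers ρ) ≤ Q₃ →
      Q₁ = Q₂ ∨ Q₁ = Q₃ ∨ Q₂ = Q₃)
    (𝒬 : Finset (Ideal (𝓞 K))) (h𝒬 : ∀ Q ∈ 𝒬, Q.IsMaximal ∧ 𝔭.map (toRingOfIntegers ρ) ≤ Q) :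
    𝒬.card ≤ Nat.card (endOrder ρ ⧸ 𝔭) := by
  have h0 : 𝔭 ≠ ⊥ := Ring.ne_bot_of_isMaximal_of_not_isField h𝔭 not_isField
  haveI := CMTypeLattice.finite_quotient_endOrder ρ h0
  haveI : Nontrivial (endOrder ρ ⧸ 𝔭) := Ideal.Quotient.nontrivial_iff.2 h𝔭.ne_top
  have h2 : 𝒬.card ≤ 2 := by
    by_contra h
    obtain ⟨a, ha, b, hb, c, hc, hab, hac, hbc⟩ := Finset.two_lt_card.1 (not_le.1 h)
    rcases h3 a b c (h𝒬 a ha).1 (h𝒬 b hb).1 (h𝒬 c hc).1 (h𝒬 a ha).2 (h𝒬 b hb).2 (h𝒬 c hc).2 with h' | h' | h'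
    exacts [hab h', hac h', hbc h']
  exact h2.trans Finite.one_lt_card

end Transport

end EndOrder

/-! ## §4 LEMMA 4.3, COROLLARY 4.4 and THEOREM 4.7 for `S = endOrder (M_μ)` under the residue bound -/

namespace CMTypeLattice

section Consequences

variable {K : Type} [Field K] [NumberField K]
variable {ι : Type} [Fintype ι] [DecidableEq ι] (μ : Basis ι ℚ K) [Nonempty ι]
variable [IsFractionRing (endOrder (Algebra.leftMulMatrix μ)) K]

/-- **GREITHER'S THEOREM 2.1 inequality `v(I) ≤ [S/mS : R/m]` at a prime under at most `#(S/𝔭)` primes of `𝒪_K`: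
`dim_{S/𝔭} I/𝔭I ≤ dim_{S/𝔭} 𝒪_K/𝔭𝒪_K` for every fractional `S`-ideal `I ≠ 0`.** [cite: Greither1982TwoGenerator, §2
Thm. 2.1, p. 267] [cite: Marseglia2024CMType, §4 Lemma 4.3, p. 10] -/
theorem finrank_quotient_smul_top_le_of_card_le {M : FractionalIdeal (endOrder (Algebra.leftMulMatrix μ))⁰ K}
    (hMO : (M : Set K) = (algebraMap (𝓞 K) K).range) {𝔭 : Ideal (endOrder (Algebra.leftMulMatrix μ))}
    [h𝔭 : 𝔭.IsMaximal]
    (hq : ∀ 𝒬 : Finset (Ideal (𝓞 K)),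
      (∀ Q ∈ 𝒬, Q.IsMaximal ∧ 𝔭.map (EndOrder.toRingOfIntegers (Algebra.leftMulMatrix μ)) ≤ Q) →
      𝒬.card ≤ Nat.card (endOrder (Algebra.leftMulMatrix μ) ⧸ 𝔭))
    {I : FractionalIdeal (endOrder (Algebra.leftMulMatrix μ))⁰ K} (hI : I ≠ 0) :
    Module.finrank (endOrder (Algebra.leftMulMatrix μ) ⧸ 𝔭)
        (↥(I : Submodule (endOrder (Algebra.leftMulMatrix μ)) K) ⧸
          (𝔭 • ⊤ : Submodule (endOrder (Algebra.leftMulMatrix μ)) (I : Submodule (endOrder (Algebra.leftMulMatrix μ)) K))) ≤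
      Module.finrank (endOrder (Algebra.leftMulMatrix μ) ⧸ 𝔭)
        (↥(M : Submodule (endOrder (Algebra.leftMulMatrix μ)) K) ⧸
          (𝔭 • ⊤ : Submodule (endOrder (Algebra.leftMulMatrix μ)) (M : Submodule (endOrder (Algebra.leftMulMatrix μ)) K))) := by
  obtain ⟨x, hx, hsup⟩ := EndOrder.exists_mem_coeIdeal_mul_le_of_card_le hMO hq
  exact finrank_quotient_smul_top_le_of_superficial μ hMO hx hsup hI

/-- **MARSEGLIA 2024 LEMMA 4.3 ([Greither82]) «`gens(S) ≤ max{2, gens_S(𝒪_K)}`», ideal by ideal, for an order whose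
non-invertible primes `𝔭` lie under at most `#(S/𝔭)` primes of `𝒪_K`: `gens_S(I) ≤ max{2, gens_S(𝒪_K)}`** (GREITHER
COR. 2.2). [cite: Marseglia2024CMType, §4 Lemma 4.3, p. 10] [cite: Greither1982TwoGenerator, §2 Cor. 2.2, p. 268] -/
theorem spanFinrank_coe_le_max_of_card_le {M : FractionalIdeal (endOrder (Algebra.leftMulMatrix μ))⁰ K}
    (hMO : (M : Set K) = (algebraMap (𝓞 K) K).range)
    (hq : ∀ 𝔭 : MaximalSpectrum (endOrder (Algebra.leftMulMatrix μ)),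
      ¬ IsUnit (𝔭.asIdeal : FractionalIdeal (endOrder (Algebra.leftMulMatrix μ))⁰ K) →
      ∀ 𝒬 : Finset (Ideal (𝓞 K)),
        (∀ Q ∈ 𝒬, Q.IsMaximal ∧ 𝔭.asIdeal.map (EndOrder.toRingOfIntegers (Algebra.leftMulMatrix μ)) ≤ Q) →
        𝒬.card ≤ Nat.card (endOrder (Algebra.leftMulMatrix μ) ⧸ 𝔭.asIdeal))
    {I : FractionalIdeal (endOrder (Algebra.leftMulMatrix μ))⁰ K} (hI : I ≠ 0) :
    (I : Submodule (endOrder (Algebra.leftMulMatrix μ)) K).spanFinrank ≤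
      max 2 (M : Submodule (endOrder (Algebra.leftMulMatrix μ)) K).spanFinrank := by
  obtain ⟨n, hn⟩ : ∃ n, max 2 (M : Submodule (endOrder (Algebra.leftMulMatrix μ)) K).spanFinrank = n + 1 + 1 :=
    ⟨max 2 (M : Submodule (endOrder (Algebra.leftMulMatrix μ)) K).spanFinrank - 2, by omega⟩
  rw [hn]
  refine EndOrder.spanFinrank_le_of_forall_finrank_quotient_le hI (by omega) fun 𝔭 ↦ ?_
  haveI := 𝔭.isMaximal
  rw [← hn]
  by_cases hu : IsUnit (𝔭.asIdeal : FractionalIdeal (endOrder (Algebra.leftMulMatrix μ))⁰ K)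
  · rw [EndOrder.finrank_quotient_eq_one_of_isUnit_coeIdeal (asIdeal_ne_bot μ 𝔭) hu hI]
    exact le_max_of_le_left one_le_two
  · exact (finrank_quotient_smul_top_le_of_card_le μ hMO (hq 𝔭 hu) hI).trans
      (le_max_of_le_right (EndOrder.finrank_quotient_smul_top_le_spanFinrank M (asIdeal_ne_bot μ 𝔭)))

/-- **MARSEGLIA 2024 COROLLARY 4.4, «`gens(S) = gens_S(𝒪_K)`», for a non-maximal order whose non-invertible primes `𝔭`
lie under at most `#(S/𝔭)` primes of `𝒪_K`** (GREITHER COR. 2.2, equality case). [cite: Marseglia2024CMType, §4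
Cor. 4.4, p. 10] [cite: Greither1982TwoGenerator, §2 Cor. 2.2, p. 268] -/
theorem iSup_spanFinrank_coe_eq_spanFinrank_coe_of_card_le
    {M : FractionalIdeal (endOrder (Algebra.leftMulMatrix μ))⁰ K}
    (hMO : (M : Set K) = (algebraMap (𝓞 K) K).range)
    (hS : ∃ a : 𝓞 K, (a : K) ∉ endOrder (Algebra.leftMulMatrix μ))
    (hq : ∀ 𝔭 : MaximalSpectrum (endOrder (Algebra.leftMulMatrix μ)),
      ¬ IsUnit (𝔭.asIdeal : FractionalIdeal (endOrder (Algebra.leftMulMatrix μ))⁰ K) →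
      ∀ 𝒬 : Finset (Ideal (𝓞 K)),
        (∀ Q ∈ 𝒬, Q.IsMaximal ∧ 𝔭.asIdeal.map (EndOrder.toRingOfIntegers (Algebra.leftMulMatrix μ)) ≤ Q) →
        𝒬.card ≤ Nat.card (endOrder (Algebra.leftMulMatrix μ) ⧸ 𝔭.asIdeal)) :
    ⨆ I : {I : FractionalIdeal (endOrder (Algebra.leftMulMatrix μ))⁰ K // I ≠ 0},
        ((I : FractionalIdeal (endOrder (Algebra.leftMulMatrix μ))⁰ K) :
          Submodule (endOrder (Algebra.leftMulMatrix μ)) K).spanFinrank =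
      (M : Submodule (endOrder (Algebra.leftMulMatrix μ)) K).spanFinrank := by
  have h2 := two_le_spanFinrank_coe_of_exists_not_mem μ hMO hS
  have hM0 := ne_zero_of_coe_eq_range μ hMO
  haveI : Nonempty {I : FractionalIdeal (endOrder (Algebra.leftMulMatrix μ))⁰ K // I ≠ 0} := ⟨⟨M, hM0⟩⟩
  refine le_antisymm (ciSup_le fun I ↦ ?_) (spanFinrank_coe_le_iSup μ hM0)
  exact (spanFinrank_coe_le_max_of_card_le μ hMO hq I.2).trans (max_le h2 le_rfl)

/-- **COROLLARY 4.4 in full under the residue bound: `gens(S) = gens_S(𝒪_K) = max_𝔭 dim_{S/𝔭} 𝒪_K/𝔭𝒪_K`.**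
[cite: Marseglia2024CMType, §4 Cor. 4.4, p. 10] -/
theorem iSup_spanFinrank_coe_eq_iSup_finrank_quotient_smul_top_of_card_le
    {M : FractionalIdeal (endOrder (Algebra.leftMulMatrix μ))⁰ K}
    (hMO : (M : Set K) = (algebraMap (𝓞 K) K).range)
    (hS : ∃ a : 𝓞 K, (a : K) ∉ endOrder (Algebra.leftMulMatrix μ))
    (hq : ∀ 𝔭 : MaximalSpectrum (endOrder (Algebra.leftMulMatrix μ)),
      ¬ IsUnit (𝔭.asIdeal : FractionalIdeal (endOrder (Algebra.leftMulMatrix μ))⁰ K) →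
      ∀ 𝒬 : Finset (Ideal (𝓞 K)),
        (∀ Q ∈ 𝒬, Q.IsMaximal ∧ 𝔭.asIdeal.map (EndOrder.toRingOfIntegers (Algebra.leftMulMatrix μ)) ≤ Q) →
        𝒬.card ≤ Nat.card (endOrder (Algebra.leftMulMatrix μ) ⧸ 𝔭.asIdeal)) :
    ⨆ I : {I : FractionalIdeal (endOrder (Algebra.leftMulMatrix μ))⁰ K // I ≠ 0},
        ((I : FractionalIdeal (endOrder (Algebra.leftMulMatrix μ))⁰ K) :
          Submodule (endOrder (Algebra.leftMulMatrix μ)) K).spanFinrank =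
      ⨆ 𝔭 : MaximalSpectrum (endOrder (Algebra.leftMulMatrix μ)),
        Module.finrank (endOrder (Algebra.leftMulMatrix μ) ⧸ 𝔭.asIdeal)
          (↥(M : Submodule (endOrder (Algebra.leftMulMatrix μ)) K) ⧸
            (𝔭.asIdeal • ⊤ : Submodule (endOrder (Algebra.leftMulMatrix μ))
              (M : Submodule (endOrder (Algebra.leftMulMatrix μ)) K))) := by
  rw [iSup_spanFinrank_coe_eq_spanFinrank_coe_of_card_le μ hMO hS hq,
    spanFinrank_coe_eq_iSup_finrank_quotient_smul_top μ hMO hS]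

/-- **MARSEGLIA 2024 PROPOSITION 4.5 «In particular, if `S` is not maximal then
`gens(S) = 1 + max{type(S + 𝔭𝒪_K) : 𝔭 a prime of S}`» under the residue bound**: a non-invertible prime `𝔭` with
`type(T) + 1 = gens(S)` for every presentation `T = endOrder (M_ν)` of `S + 𝔭𝒪_K`. [cite: Marseglia2024CMType, §4
Prop. 4.5 («In particular») and Cor. 4.4, p. 10] -/
theorem exists_not_isUnit_forall_iSup_add_one_eq_iSup_spanFinrank_of_card_le
    {M : FractionalIdeal (endOrder (Algebra.leftMulMatrix μ))⁰ K}
    (hMO : (M : Set K) = (algebraMap (𝓞 K) K).range)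
    (hS : ∃ a : 𝓞 K, (a : K) ∉ endOrder (Algebra.leftMulMatrix μ))
    (hq : ∀ 𝔭 : MaximalSpectrum (endOrder (Algebra.leftMulMatrix μ)),
      ¬ IsUnit (𝔭.asIdeal : FractionalIdeal (endOrder (Algebra.leftMulMatrix μ))⁰ K) →
      ∀ 𝒬 : Finset (Ideal (𝓞 K)),
        (∀ Q ∈ 𝒬, Q.IsMaximal ∧ 𝔭.asIdeal.map (EndOrder.toRingOfIntegers (Algebra.leftMulMatrix μ)) ≤ Q) →
        𝒬.card ≤ Nat.card (endOrder (Algebra.leftMulMatrix μ) ⧸ 𝔭.asIdeal)) :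
    ∃ 𝔭 : MaximalSpectrum (endOrder (Algebra.leftMulMatrix μ)),
      ¬ IsUnit (𝔭.asIdeal : FractionalIdeal (endOrder (Algebra.leftMulMatrix μ))⁰ K) ∧
      ∀ ν : Basis ι ℚ K, (∀ x : K, x ∈ endOrder (Algebra.leftMulMatrix ν) ↔
          ∃ s ∈ endOrder (Algebra.leftMulMatrix μ),
            ∃ y ∈ (𝔭.asIdeal : FractionalIdeal (endOrder (Algebra.leftMulMatrix μ))⁰ K) * M, x = s + y) →
        ∀ T' : FractionalIdeal (endOrder (Algebra.leftMulMatrix ν))⁰ K,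
          (T' : Submodule (endOrder (Algebra.leftMulMatrix ν)) K) =
            traceDual ℤ ℚ ((1 : FractionalIdeal (endOrder (Algebra.leftMulMatrix ν))⁰ K) :
              Submodule (endOrder (Algebra.leftMulMatrix ν)) K) →
          (⨆ 𝔔 : MaximalSpectrum (endOrder (Algebra.leftMulMatrix ν)),
              Module.finrank (endOrder (Algebra.leftMulMatrix ν) ⧸ 𝔔.asIdeal)
                ((T' : Submodule (endOrder (Algebra.leftMulMatrix ν)) K) ⧸
                  (𝔔.asIdeal • ⊤ : Submodule (endOrder (Algebra.leftMulMatrix ν))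
                    (T' : Submodule (endOrder (Algebra.leftMulMatrix ν)) K)))) + 1 =
            ⨆ I : {I : FractionalIdeal (endOrder (Algebra.leftMulMatrix μ))⁰ K // I ≠ 0},
              ((I : FractionalIdeal (endOrder (Algebra.leftMulMatrix μ))⁰ K) :
                Submodule (endOrder (Algebra.leftMulMatrix μ)) K).spanFinrank := by
  rw [iSup_spanFinrank_coe_eq_spanFinrank_coe_of_card_le μ hMO hS hq]
  exact exists_not_isUnit_forall_iSup_add_one_eq_spanFinrank_coe μ hMO hS

/-- **MARSEGLIA 2024 THEOREM 4.7, (iii) ⟺ (vi) «`gens(S) = gens_S(𝒪_K/S) + 1`» under the residue bound.**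
[cite: Marseglia2024CMType, §4 Thm. 4.7 ((iii) ⟺ (vi)), p. 11] -/
theorem iSup_spanFinrank_coe_eq_spanFinrank_top_quotient_add_one_of_card_le
    {M : FractionalIdeal (endOrder (Algebra.leftMulMatrix μ))⁰ K}
    (hMO : (M : Set K) = (algebraMap (𝓞 K) K).range)
    (hS : ∃ a : 𝓞 K, (a : K) ∉ endOrder (Algebra.leftMulMatrix μ))
    (hq : ∀ 𝔭 : MaximalSpectrum (endOrder (Algebra.leftMulMatrix μ)),
      ¬ IsUnit (𝔭.asIdeal : FractionalIdeal (endOrder (Algebra.leftMulMatrix μ))⁰ K) →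
      ∀ 𝒬 : Finset (Ideal (𝓞 K)),
        (∀ Q ∈ 𝒬, Q.IsMaximal ∧ 𝔭.asIdeal.map (EndOrder.toRingOfIntegers (Algebra.leftMulMatrix μ)) ≤ Q) →
        𝒬.card ≤ Nat.card (endOrder (Algebra.leftMulMatrix μ) ⧸ 𝔭.asIdeal)) :
    ⨆ I : {I : FractionalIdeal (endOrder (Algebra.leftMulMatrix μ))⁰ K // I ≠ 0},
        ((I : FractionalIdeal (endOrder (Algebra.leftMulMatrix μ))⁰ K) :
          Submodule (endOrder (Algebra.leftMulMatrix μ)) K).spanFinrank =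
      (⊤ : Submodule (endOrder (Algebra.leftMulMatrix μ))
        ((M : Submodule (endOrder (Algebra.leftMulMatrix μ)) K) ⧸
          (1 : Submodule (endOrder (Algebra.leftMulMatrix μ)) K).comap
            (M : Submodule (endOrder (Algebra.leftMulMatrix μ)) K).subtype)).spanFinrank + 1 := by
  rw [iSup_spanFinrank_coe_eq_spanFinrank_coe_of_card_le μ hMO hS hq,
    spanFinrank_top_quotient_add_one_eq_spanFinrank_coe μ hMO hS]

/-- **MARSEGLIA 2024 THEOREM 4.7, (i) ⟺ (vi) «`gens(S) = 1 + max_{T ∈ 𝒮} type(T)`» under the residue bound**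
(`≤` for every over-order `T = endOrder (M_ν) ⊇ S` unconditionally, `=` for some `T = S + 𝔭𝒪_K`).
[cite: Marseglia2024CMType, §4 Thm. 4.7 ((i) ⟺ (vi)), p. 11] -/
theorem forall_le_and_exists_eq_iSup_spanFinrank_of_card_le
    {M : FractionalIdeal (endOrder (Algebra.leftMulMatrix μ))⁰ K}
    (hMO : (M : Set K) = (algebraMap (𝓞 K) K).range)
    (hS : ∃ a : 𝓞 K, (a : K) ∉ endOrder (Algebra.leftMulMatrix μ))
    (hq : ∀ 𝔭 : MaximalSpectrum (endOrder (Algebra.leftMulMatrix μ)),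
      ¬ IsUnit (𝔭.asIdeal : FractionalIdeal (endOrder (Algebra.leftMulMatrix μ))⁰ K) →
      ∀ 𝒬 : Finset (Ideal (𝓞 K)),
        (∀ Q ∈ 𝒬, Q.IsMaximal ∧ 𝔭.asIdeal.map (EndOrder.toRingOfIntegers (Algebra.leftMulMatrix μ)) ≤ Q) →
        𝒬.card ≤ Nat.card (endOrder (Algebra.leftMulMatrix μ) ⧸ 𝔭.asIdeal)) :
    (∀ ν : Basis ι ℚ K, endOrder (Algebra.leftMulMatrix μ) ≤ endOrder (Algebra.leftMulMatrix ν) →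
      ∀ T' : FractionalIdeal (endOrder (Algebra.leftMulMatrix ν))⁰ K,
        (T' : Submodule (endOrder (Algebra.leftMulMatrix ν)) K) =
          traceDual ℤ ℚ ((1 : FractionalIdeal (endOrder (Algebra.leftMulMatrix ν))⁰ K) :
            Submodule (endOrder (Algebra.leftMulMatrix ν)) K) →
        (⨆ 𝔔 : MaximalSpectrum (endOrder (Algebra.leftMulMatrix ν)),
            Module.finrank (endOrder (Algebra.leftMulMatrix ν) ⧸ 𝔔.asIdeal)
              ((T' : Submodule (endOrder (Algebra.leftMulMatrix ν)) K) ⧸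
                (𝔔.asIdeal • ⊤ : Submodule (endOrder (Algebra.leftMulMatrix ν))
                  (T' : Submodule (endOrder (Algebra.leftMulMatrix ν)) K)))) + 1 ≤
          ⨆ I : {I : FractionalIdeal (endOrder (Algebra.leftMulMatrix μ))⁰ K // I ≠ 0},
            ((I : FractionalIdeal (endOrder (Algebra.leftMulMatrix μ))⁰ K) :
              Submodule (endOrder (Algebra.leftMulMatrix μ)) K).spanFinrank) ∧
    ∃ ν : Basis ι ℚ K, endOrder (Algebra.leftMulMatrix μ) ≤ endOrder (Algebra.leftMulMatrix ν) ∧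
      ∀ T' : FractionalIdeal (endOrder (Algebra.leftMulMatrix ν))⁰ K,
        (T' : Submodule (endOrder (Algebra.leftMulMatrix ν)) K) =
          traceDual ℤ ℚ ((1 : FractionalIdeal (endOrder (Algebra.leftMulMatrix ν))⁰ K) :
            Submodule (endOrder (Algebra.leftMulMatrix ν)) K) →
        (⨆ 𝔔 : MaximalSpectrum (endOrder (Algebra.leftMulMatrix ν)),
            Module.finrank (endOrder (Algebra.leftMulMatrix ν) ⧸ 𝔔.asIdeal)
              ((T' : Submodule (endOrder (Algebra.leftMulMatrix ν)) K) ⧸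
                (𝔔.asIdeal • ⊤ : Submodule (endOrder (Algebra.leftMulMatrix ν))
                  (T' : Submodule (endOrder (Algebra.leftMulMatrix ν)) K)))) + 1 =
          ⨆ I : {I : FractionalIdeal (endOrder (Algebra.leftMulMatrix μ))⁰ K // I ≠ 0},
            ((I : FractionalIdeal (endOrder (Algebra.leftMulMatrix μ))⁰ K) :
              Submodule (endOrder (Algebra.leftMulMatrix μ)) K).spanFinrank := by
  refine ⟨fun ν hST T' hT' ↦ ?_, ?_⟩
  · haveI := isFractionRing_endOrder (Algebra.leftMulMatrix ν)
    exact iSup_finrank_traceDual_quotient_add_one_le_iSup_spanFinrank_of_le μ hS hST hT'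
  · obtain ⟨𝔭, -, h𝔭⟩ := exists_not_isUnit_forall_iSup_add_one_eq_iSup_spanFinrank_of_card_le μ hMO hS hq
    obtain ⟨ν, hν⟩ := exists_basis_mem_endOrder_iff_exists_add μ hMO 𝔭.asIdeal
    exact ⟨ν, endOrder_le_endOrder_of_mem_iff μ ν hν, h𝔭 ν hν⟩

end Consequences

end CMTypeLattice

end Literature.NumberTheory.ComplexMultiplication
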